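/-
Copyright (c) 2026. All rights reserved.
Released under Apache 2.0 license as described in the file LICENSE.
Authors: abc-iut cell, wave-4 seat abc-iut-w4-d083 (L3 sub-DAG [SemiAnbd] Thm 5.4, umbrella junction v5
«parametric ι»: the datum `ι g` read through the tempered charts).
-/
import Literature.AnabelianGeometry.SemiGraphs.ArithThm54iiiUmbrellaOfChart
import Literature.AnabelianGeometry.SemiGraphs.ArithIotaShadowsTransport
import HarnessLib

/-!
# [SemiAnbd] Theorem 5.4 (iii), COMPATIBLE reading, at the produced data — junction v5: the datum
# `ι g = B^temp(g)|_{geom}` ELIMINATED through the tempered charts (proof-only)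

Mochizuki, *Semi-graphs of anabelioids*, Publ. RIMS **42** (2006), §5, Theorem 5.4 (iii) p. 66 ("Applying
`B^temp(−)` … the proofs are entirely parallel to those of Theorem 3.7, Corollary 3.9"), with the data of p. 65
(`Π^temp_{𝔊,v} := C_{Π^temp_𝔊}(Π^temp_{𝔾,v})`) and Prop. 3.2 p. 35 (every morphism of temperoids
`B^temp(𝔾) → B^temp(ℍ)` is `B^temp(φ̂)` for a continuous `φ̂ : π₁^temp(𝔾) → π₁^temp(ℍ)`, unique up to
`π₁^temp(ℍ)`-conjugacy) [cite: MochizukiSemiAnbd2006, Thm 5.4 (iii), p. 66].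

PROOF-ONLY (cell abc-iut, layer L3; L3-lead ruling α66 «d141-v5», shape ruling of abc-iut-w4-d053
2026-08-26T08:55:46Z adopting abc-iut-w5-d141's parametric sketch; seat abc-iut-w4-d083; no definition, nothing
asserted).  Junction v4 (`arithQuasiGeometricCorrespondenceStatementCompat_ofChart`, abc-iut-w5-d141) concludes
abc-iut-w4-d083's `ArithQuasiGeometricCorrespondenceStatementCompat 𝔊 ℍ e augG augH btemp` at the PRODUCED
decomposition data `decompositionDataOfChart R𝒢 ι𝒢` / `decompositionDataOfChart Rℋ ιℋ` of the tempered charts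
`c𝒢`, `cℋ`, but still carries the abstract kernel-level datum `ι : (𝔊.G ⟶ ℍ.G) → (Ker aug_𝔊 →* Π^temp_ℍ)`
("`B^temp(g)` on the geometric tempered groups") with NINE binders about it: `hιG hιH hιinj hιbtemp hιgeomV
hιgeomE hιgeomC hCor39c` (+ `ι` itself).  This file READS `ι` THROUGH THE CHARTS: the dictionary is a Prop-3.2
representative `rep g = φ̂_g : π₁^temp(𝔾) →ₜ* π₁^temp(ℍ)` of `B^temp(g)` for every `g : 𝔊.G ⟶ ℍ.G`, and inside
the proof `ι g := ι_ℍ ∘ φ̂_g ∘ ι_𝔾⁻¹` on `Ker aug_𝔊 = ι_𝔾(π₁^temp(𝔾))` (Prop. 5.2 (iv)).  Then: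
* `hιgeomV` / `hιgeomE` / `hιgeomC` are DISCHARGED — but only where the umbrella actually uses them, at
  `g = φ.geom` for a LOCALLY OPEN `φ` — by abc-iut-w4-d083's `iotaShadows_of_compatVAt`
  (`ArithIotaShadowsTransport.lean`, chart → kernel) from the dictionary clause `hrepOpen` ("`B^temp(φ.geom)` is
  induced, for some family of conjugating elements, by a LOCALLY OPEN morphism of semi-graphs of anabelioids
  `F : 𝔾 → ℍ`", Prop. 3.6 (iv) / Cor. 3.9 (a)) and the hypothesis-free (R1) `Hom.compat_of_chartPullbackWith_iso`;
  the umbrella's `∀ g` form of `hιgeomV`/`hιgeomE` (open images for EVERY `g`) is thereby replaced by the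
  per-`φ` form print needs (clause 1 is about locally open `φ` only) — the assembly below re-runs junction v3b's
  three clauses with the per-`φ` data (`mapsOntoOpenSubgroupOf_of_kerAgree` + abc-iut-w4-d106's
  `hv_of_geomOpen` / `hb_of_geomOpen`);
* `hCor39c` (the compatible geometric Cor. 3.9 (b) at the kernels, `∀ f`) is DISCHARGED by abc-iut-w4-d083's
  `exists_hom_chartPullbackWith_iso_of_kernelShadows` (`ArithCor39cTransport.lean`, kernel → chart: a locally
  open `F` and `θ` with `F^*_θ ≅ B^temp(f')` for the restriction `f'` of `f`) + the dictionary clause `hrepSurj`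
  ("every homomorphism inducing a locally open `(F, θ)` is `B^temp`-read by some `g`, up to isomorphism of
  pull-back functors") + Prop. 3.2 (`BTemp.exists_conj_of_natTrans`: isomorphic pull-back functors ⇒ conjugate
  homomorphisms) — `ProfiniteSemiGraph.hCor39c_of_repSurj`;
* `hιG` / `hιH` / `hιinj` / `hιbtemp` are RESTATED at the chart level (`hrepG hrepH hrepInj hbtempRep`: the same
  identities pushed through the embeddings `ι_𝔾`, `ι_ℍ`; `hrepInj` = "`B^temp`-conjugate representatives come
  from the same `g`", `hbtempRep` = the compatibility requirement «`B^temp(φ) ∘ ι_𝔾 = ι_ℍ ∘ φ̂_{φ.geom}` up to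
  `Ker(aug_ℍ)`-conjugacy» on whoever instantiates `btemp`) and the kernel-level forms are DERIVED inside the proof
  (`exists_kerSection_of_range_eq_ker`: a group-theoretic section `Ker aug_𝔊 →* π₁^temp(𝔾)` of `ι_𝔾`).
REMAINING binders, all producer data (T54-0/T54-B, HOME/plan/L3/SUBDAG-SemiAnbd-Thm54.md) or print hypotheses:
Thm 5.4 (ii) ×2 and Rmk 5.3.1 ×2 at the produced data (`hIIG hIIH hRG hRH`), the arithmetic `B^temp` (`btemp`,
`haugH hcont hover`), the representatives `rep` with `hrepOpen hrepSurj hrepG hrepH hrepInj hbtempRep`, the branch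
commensurators `hcommB hcommB'`, `hsurjG`, continuity of `e`; frames: Thm 3.7 (iii) AT `𝔾` AND AT `ℍ`
(`CompactInVerticialAt`), the Cor. 3.9 frames at `𝔾` and `ℍ`, injective `ι_𝔾` (continuous) / `ι_ℍ` (embedding)
with `range = Ker`, the two `ArithChartAction`s.  Nothing asserted for real tempered data; nothing here bears on
[IUTchIII] Cor. 3.12; typed ≠ proved for the inputs.
-/

namespace Literature.AnabelianGeometry.SemiGraphs

open _root_.CategoryTheory _root_.Topology ProfiniteSemiGraph

universe u v w u₀ uG uH uP uI

/-! ### Bookkeeping: a section of `Ker aug_𝔊` through the geometric chart (Prop. 5.2 (iv)) -/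

section Bookkeeping

variable {P : Type*} [Group P] {Gtp : Type uG} [Group Gtp] {PA : Type uP} [Group PA]

/-- **A section of the kernel through the chart** (Prop. 5.2 (iv) exact sequence
`1 → π₁^temp(𝔾) → Π^temp_𝔊 → Π_A → 1`): if `ι_𝔾 : π₁^temp(𝔾) → Π^temp_𝔊` is injective with image
`Ker aug_𝔊`, there is a homomorphism `s : Ker aug_𝔊 → π₁^temp(𝔾)` with `ι_𝔾 ∘ s = incl` — so that
`ι g := ι_ℍ ∘ φ̂_g ∘ s` is the kernel-level reading of a chart-level `φ̂_g`.
[cite: MochizukiSemiAnbd2006, Prop 5.2 (iv), p. 64] -/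
theorem exists_kerSection_of_range_eq_ker (ι𝒢 : P →* Gtp) (hι𝒢 : Function.Injective ι𝒢)
    (aug : Gtp →* PA) (hexact : ι𝒢.range = aug.ker) :
    ∃ s : aug.ker →* P, ∀ x : aug.ker, ι𝒢 (s x) = (x : Gtp) := by
  refine ⟨(MonoidHom.ofInjective hι𝒢).symm.toMonoidHom.comp
      (MulEquiv.subgroupCongr hexact.symm).toMonoidHom, fun x => ?_⟩
  change ι𝒢 ((MonoidHom.ofInjective hι𝒢).symm (MulEquiv.subgroupCongr hexact.symm x)) = _
  rw [MonoidHom.apply_ofInjective_symm]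
  rfl

end Bookkeeping

/-! ### `hCor39c` discharged through the charts -/

namespace ProfiniteSemiGraph

variable {𝒢 ℋ : ProfiniteSemiGraph.{u₀}} {c𝒢 : TemperedPiChart 𝒢} {cℋ : TemperedPiChart ℋ}
variable {Gtp : Type uG} [Group Gtp] [TopologicalSpace Gtp]
variable {Htp : Type uH} [Group Htp] [TopologicalSpace Htp] [IsTopologicalGroup Htp]
variable {PA : Type uP} [Group PA] [TopologicalSpace PA]
variable {I : Type uI}

/-- **The junction binder `hCor39c`, DISCHARGED through the tempered charts** (Thm 5.4 (iii) ↔ Cor. 3.9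
(b), compatible reading; modulo Thm 3.7 (iii) AT `𝔾` AND AT `ℍ`).  For a family of chart-level
representatives `rep i : π₁^temp(𝔾) →ₜ* π₁^temp(ℍ)` read on the kernel as `ι i` (`ι i ∘ ι_𝔾 = ι_ℍ ∘ rep i`)
such that every homomorphism inducing the pull-back functor `F^*_θ` of a LOCALLY OPEN `F : 𝔾 → ℍ` is,
up to isomorphism of pull-back functors, some `rep i` (`hsurj` — "`B^temp` reaches every locally open
arrow"), every continuous `f : Π^temp_𝔊 → Π^temp_ℍ` over `A` with the three kernel-level shadows (per
vertex, per branch, compatibility) is `h · ι i · h⁻¹` on `Ker aug_𝔊` for some `i` and some GEOMETRIC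
`h ∈ Ker aug_ℍ`: abc-iut-w4-d083's `exists_hom_chartPullbackWith_iso_of_kernelShadows` (restriction `f'`,
locally open `F`, `θ`, `F^*_θ ≅ B^temp(f')`), then `hsurj`, then Prop. 3.2 (`BTemp.exists_conj_of_natTrans`:
`B^temp(rep i) ≅ B^temp(f')` ⇒ `f' = k · rep i · k⁻¹`), then `h := ι_ℍ(k)`.
[cite: MochizukiSemiAnbd2006, Thm 5.4 (iii), p. 66] -/
theorem hCor39c_of_repSurj (h𝒢iii : CompactInVerticialAt 𝒢) (hℋiii : CompactInVerticialAt ℋ)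
    (h𝒢 : Cor39Hypotheses 𝒢) (hℋ : Cor39Hypotheses ℋ) (R : ChartRepresentatives c𝒢)
    (R' : ChartRepresentatives cℋ) (ι𝒢 : c𝒢.G →* Gtp) (ιℋ : cℋ.G →* Htp)
    (hι𝒢 : Function.Injective ι𝒢) (hι𝒢c : Continuous ι𝒢) (hιℋ : Function.Injective ιℋ)
    (hιℋe : IsEmbedding ιℋ) (augG : Gtp →* PA) (augH' : Htp →* PA) (hex𝒢 : ι𝒢.range = augG.ker)
    (hexℋ : ιℋ.range = augH'.ker)
    {actV : PA → ℋ.graph.Vertex → ℋ.graph.Vertex} {actE : PA → ℋ.graph.Edge → ℋ.graph.Edge}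
    {actB : PA → ℋ.graph.Branch → ℋ.graph.Branch} (A : ArithChartAction cℋ ιℋ augH' actV actE actB)
    (rep : I → (c𝒢.G →ₜ* cℋ.G))
    (hsurj : ∀ (F : Hom 𝒢 ℋ) (θ : F.ConjugatorFamily) (f' : c𝒢.G →ₜ* cℋ.G), F.IsLocallyOpen →
      Nonempty (F.chartPullbackWith θ c𝒢 cℋ ≅ BTemp.res f') →
        ∃ i : I, Nonempty (BTemp.res (rep i) ≅ BTemp.res f'))
    (ι : I → (augG.ker →* Htp))
    (hι : ∀ (i : I) (x : augG.ker) (y : c𝒢.G), (x : Gtp) = ι𝒢 y → ι i x = ιℋ (rep i y)) :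
    ∀ f : Gtp →* Htp, Continuous f → augH'.comp f = augG →
      (∀ v : 𝒢.graph.Vertex, ∃ (w : ℋ.graph.Vertex) (x : Htp),
        MapsOntoOpenSubgroupOf f ((decompositionDataOfChart R ι𝒢).vertGp v ⊓ augG.ker)
          (conjSubgroup x ((decompositionDataOfChart R' ιℋ).vertGp w) ⊓ augH'.ker)) →
      (∀ b : 𝒢.graph.Branch, ∃ (b' : ℋ.graph.Branch) (x : Htp),
        MapsOntoOpenSubgroupOf f ((decompositionDataOfChart R ι𝒢).brGp b ⊓ augG.ker)
          (conjSubgroup x ((decompositionDataOfChart R' ιℋ).brGp b') ⊓ augH'.ker)) →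
      (∀ (v₁ v₂ : 𝒢.graph.Vertex) (γ₁ γ₂ : Gtp),
        conjSubgroup γ₁ ((decompositionDataOfChart R ι𝒢).vertGp v₁) ⊓ augG.ker ≠
            conjSubgroup γ₂ ((decompositionDataOfChart R ι𝒢).vertGp v₂) ⊓ augG.ker →
        conjSubgroup γ₁ ((decompositionDataOfChart R ι𝒢).vertGp v₁) ⊓
            conjSubgroup γ₂ ((decompositionDataOfChart R ι𝒢).vertGp v₂) ⊓ augG.ker ≠ ⊥ →
          ∃ (w₁ w₂ : ℋ.graph.Vertex) (x₁ x₂ : Htp),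
            conjSubgroup x₁ ((decompositionDataOfChart R' ιℋ).vertGp w₁) ⊓ augH'.ker ≠
                conjSubgroup x₂ ((decompositionDataOfChart R' ιℋ).vertGp w₂) ⊓ augH'.ker ∧
            (conjSubgroup γ₁ ((decompositionDataOfChart R ι𝒢).vertGp v₁) ⊓ augG.ker).map f ≤
                conjSubgroup x₁ ((decompositionDataOfChart R' ιℋ).vertGp w₁) ∧
            (conjSubgroup γ₂ ((decompositionDataOfChart R ι𝒢).vertGp v₂) ⊓ augG.ker).map f ≤
                conjSubgroup x₂ ((decompositionDataOfChart R' ιℋ).vertGp w₂)) →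
      ∃ i : I, ∃ h ∈ augH'.ker, ∀ x : augG.ker, f x = h * ι i x * h⁻¹ := by
  intro f hf hover h1 h2 h3
  obtain ⟨f', hf', F, hF, θ, hiso⟩ := exists_hom_chartPullbackWith_iso_of_kernelShadows h𝒢iii hℋiii
    h𝒢 hℋ R R' ι𝒢 ιℋ hι𝒢 hι𝒢c hιℋ hιℋe augG augH' hex𝒢 hexℋ A f hf hover h1 h2 h3
  obtain ⟨i, ⟨η⟩⟩ := hsurj F θ f' hF hiso
  obtain ⟨k, hk, -⟩ := BTemp.exists_conj_of_natTrans cℋ.isTempered (rep i) f' η.hom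
  refine ⟨i, ιℋ k, hexℋ.le ⟨k, rfl⟩, fun x => ?_⟩
  obtain ⟨y, hy⟩ : (x : Gtp) ∈ ι𝒢.range := by
    rw [hex𝒢]
    exact x.2
  rw [hι i x y hy.symm, ← hy, ← hf' y, ← hk y, map_mul, map_mul, map_inv]

end ProfiniteSemiGraph

/-! ### Junction v5: Theorem 5.4 (iii), compatible reading, at the produced data, `ι` read through the charts -/

variable {Obj : Type u} [Category.{v} Obj] {𝓥 : SemiAnbdVocab.{u, v, w} Obj}
variable {𝔊 ℍ : ArithSemiGraph 𝓥} {e : 𝔊.PA ≃* ℍ.PA}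
variable {𝒢 ℋ : ProfiniteSemiGraph.{u₀}} {c𝒢 : TemperedPiChart 𝒢} {cℋ : TemperedPiChart ℋ}
variable {Gtp : Type uG} [Group Gtp] [TopologicalSpace Gtp]
variable {Htp : Type uH} [Group Htp] [TopologicalSpace Htp] [IsTopologicalGroup Htp] [T2Space Htp]

/-- **[SemiAnbd] Theorem 5.4 (iii), COMPATIBLE reading, at the PRODUCED decomposition data, junction v5
(«parametric ι»)**: abc-iut-w4-d083's `ArithQuasiGeometricCorrespondenceStatementCompat 𝔊 ℍ e augG augH btemp`
— (1) `B^temp(φ)` of a locally open `φ` over `A` is arithmetically COMPATIBLY quasi-geometric, (2) two such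
`φ`, `ψ` are inner-equivalent iff `B^temp(ψ)` is an inner conjugate of `B^temp(φ)`, (3) every arithmetically
compatibly quasi-geometric continuous `f` over `A` is an inner conjugate of some `B^temp(φ)` — at
`D := decompositionDataOfChart R𝒢 ι𝒢`, `D' := decompositionDataOfChart Rℋ ιℋ` (p. 65), with the datum
`ι g = B^temp(g)|_{geom}` of junctions v3b/v3c/v4 READ THROUGH THE TEMPERED CHARTS: the input is a Prop-3.2
representative `rep g = φ̂_g : π₁^temp(𝔾) →ₜ* π₁^temp(ℍ)` of `B^temp(g)` for each `g : 𝔊.G ⟶ ℍ.G` together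
with (a) `hrepOpen` — for locally open `φ`, `φ̂_{φ.geom}` induces `F^*_θ` for a LOCALLY OPEN morphism of
semi-graphs of anabelioids `F : 𝔾 → ℍ` and some family `θ` of conjugating elements (Prop. 3.6 (iv));
(b) `hrepSurj` — every homomorphism inducing such a locally open `F^*_θ` is, up to isomorphism of pull-back
functors, some `φ̂_g` ("`B^temp` reaches every locally open arrow"); (c) `hrepG` / `hrepH` — the
`Π_A`-equivariance of `g ↦ φ̂_g` through the arithmetic actions `𝔊.ρ`, `ℍ.ρ` read on the charts (Def. 5.1 (i),
Prop. 5.2 (iv)); (d) `hrepInj` — conjugate representatives come from the same `g` (Prop. 3.2 uniqueness);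
(e) `hbtempRep` — `B^temp(φ) ∘ ι_𝔾 = ι_ℍ ∘ φ̂_{φ.geom}` up to `Ker(aug_ℍ)`-conjugacy.  DISCHARGED here
relative to junction v4: `hιgeomV`, `hιgeomE`, `hιgeomC` (per locally open `φ`, by `iotaShadows_of_compatVAt`)
and `hCor39c` (by `hCor39c_of_repSurj`); DERIVED inside: the kernel-level `ι`, `hιG`, `hιH`, `hιinj`,
`hιbtemp`; DISCHARGED as in v4: `hadj`, `hEgeom`, `hslim`, `hcommV`, `hcommV'`, `hV`.  CONDITIONAL on exactly
the displayed inputs; nothing asserted; no side on [IUTchIII] Cor 3.12.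
[cite: MochizukiSemiAnbd2006, Thm 5.4 (iii), p. 66] -/
theorem arithQuasiGeometricCorrespondenceStatementCompat_ofRep (augG : Gtp →* 𝔊.PA) (augH : Htp →* ℍ.PA)
    (btemp : (φ : ArithHom 𝓥 𝔊 ℍ) → φ.IsLocallyOpen → ArithHom.IsOverA 𝔊 ℍ e φ → (Gtp →* Htp))
    -- the geometric frames: Thm 3.7 (iii) and the Cor 3.9 hypotheses AT `𝔾` AND AT `ℍ`
    (h𝒢iii : CompactInVerticialAt 𝒢) (h𝒢 : Cor39Hypotheses 𝒢) (hℋiii : CompactInVerticialAt ℋ)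
    (hℋ : Cor39Hypotheses ℋ) (R𝒢 : ChartRepresentatives c𝒢) (Rℋ : ChartRepresentatives cℋ)
    -- Prop 5.2 (iv): the geometric tempered groups inside the arithmetic ones
    (ι𝒢 : c𝒢.G →* Gtp) (hι𝒢 : Function.Injective ι𝒢) (hι𝒢c : Continuous ι𝒢) (ιℋ : cℋ.G →* Htp)
    (hιℋ : Function.Injective ιℋ) (hιℋe : IsEmbedding ιℋ) (hex𝒢 : ι𝒢.range = augG.ker)
    (hexℋ : ιℋ.range = (e.symm.toMonoidHom.comp augH).ker)
    {actV : 𝔊.PA → 𝒢.graph.Vertex → 𝒢.graph.Vertex} {actE : 𝔊.PA → 𝒢.graph.Edge → 𝒢.graph.Edge}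
    {actB : 𝔊.PA → 𝒢.graph.Branch → 𝒢.graph.Branch} (A𝒢 : ArithChartAction c𝒢 ι𝒢 augG actV actE actB)
    {actV' : 𝔊.PA → ℋ.graph.Vertex → ℋ.graph.Vertex} {actE' : 𝔊.PA → ℋ.graph.Edge → ℋ.graph.Edge}
    {actB' : 𝔊.PA → ℋ.graph.Branch → ℋ.graph.Branch}
    (Aℋ : ArithChartAction cℋ ιℋ (e.symm.toMonoidHom.comp augH) actV' actE' actB')
    -- Thm 5.4 (ii) and Rmk 5.3.1 at the produced data; the arithmetic `B^temp`
    (hIIG : ArithMaximalCompactStatementII (decompositionDataOfChart R𝒢 ι𝒢) augG)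
    (hIIH : ArithMaximalCompactStatementII (decompositionDataOfChart Rℋ ιℋ) (e.symm.toMonoidHom.comp augH))
    (hRG : VerticialEdgeLikeCompactAmpleStatement (decompositionDataOfChart R𝒢 ι𝒢) augG)
    (hRH : VerticialEdgeLikeCompactAmpleStatement (decompositionDataOfChart Rℋ ιℋ) (e.symm.toMonoidHom.comp augH))
    (haugH : Continuous (e.symm.toMonoidHom.comp augH))
    (hcont : ∀ (φ : ArithHom 𝓥 𝔊 ℍ) (h₁ : φ.IsLocallyOpen) (h₂ : ArithHom.IsOverA 𝔊 ℍ e φ),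
      Continuous (btemp φ h₁ h₂))
    (hover : ∀ (φ : ArithHom 𝓥 𝔊 ℍ) (h₁ : φ.IsLocallyOpen) (h₂ : ArithHom.IsOverA 𝔊 ℍ e φ),
      (e.symm.toMonoidHom.comp augH).comp (btemp φ h₁ h₂) = augG)
    -- the dictionary: Prop 3.2 representatives of `B^temp(g)` on the geometric tempered charts
    (rep : (𝔊.G ⟶ ℍ.G) → (c𝒢.G →ₜ* cℋ.G))
    (hrepOpen : ∀ (φ : ArithHom 𝓥 𝔊 ℍ), φ.IsLocallyOpen →
      ∃ (F : Hom 𝒢 ℋ) (θ : F.ConjugatorFamily), F.IsLocallyOpen ∧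
        Nonempty (F.chartPullbackWith θ c𝒢 cℋ ≅ BTemp.res (rep φ.geom)))
    (hrepSurj : ∀ (F : Hom 𝒢 ℋ) (θ : F.ConjugatorFamily) (f' : c𝒢.G →ₜ* cℋ.G), F.IsLocallyOpen →
      Nonempty (F.chartPullbackWith θ c𝒢 cℋ ≅ BTemp.res f') →
        ∃ g : 𝔊.G ⟶ ℍ.G, Nonempty (BTemp.res (rep g) ≅ BTemp.res f'))
    (hrepG : ∀ (g : 𝔊.G ⟶ ℍ.G) (a : 𝔊.PA) (γ : Gtp), augG γ = a →
      ∃ δ ∈ (e.symm.toMonoidHom.comp augH).ker, ∀ y y' : c𝒢.G, ι𝒢 y' = γ * ι𝒢 y * γ⁻¹ →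
        ιℋ (rep ((𝔊.ρ a).hom ≫ g) y) = δ * ιℋ (rep g y') * δ⁻¹)
    (hrepH : ∀ (g : 𝔊.G ⟶ ℍ.G) (a : 𝔊.PA) (η : Htp), (e.symm.toMonoidHom.comp augH) η = a →
      ∃ δ ∈ (e.symm.toMonoidHom.comp augH).ker, ∀ y : c𝒢.G,
        ιℋ (rep (g ≫ (ℍ.ρ (e a)).hom) y) = δ * (η * ιℋ (rep g y) * η⁻¹) * δ⁻¹)
    (hrepInj : ∀ (g₁ g₂ : 𝔊.G ⟶ ℍ.G) (k : cℋ.G), (∀ y : c𝒢.G, k * rep g₂ y * k⁻¹ = rep g₁ y) → g₁ = g₂)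
    (hbtempRep : ∀ (φ : ArithHom 𝓥 𝔊 ℍ) (h₁ : φ.IsLocallyOpen) (h₂ : ArithHom.IsOverA 𝔊 ℍ e φ),
      ∃ δ ∈ (e.symm.toMonoidHom.comp augH).ker, ∀ y : c𝒢.G,
        btemp φ h₁ h₂ (ι𝒢 y) = δ * ιℋ (rep φ.geom y) * δ⁻¹)
    -- the branch commensurators of p. 65 (`ArithChartBranchAction.hcommB_At` modulo no branch switching)
    (hcommB : ∀ b : 𝒢.graph.Branch, Subgroup.Commensurable.commensurator
      ((decompositionDataOfChart R𝒢 ι𝒢).brGp b ⊓ augG.ker) = (decompositionDataOfChart R𝒢 ι𝒢).brGp b)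
    (hcommB' : ∀ b' : ℋ.graph.Branch, Subgroup.Commensurable.commensurator
      ((decompositionDataOfChart Rℋ ιℋ).brGp b' ⊓ (e.symm.toMonoidHom.comp augH).ker) =
        (decompositionDataOfChart Rℋ ιℋ).brGp b')
    (hsurjG : Function.Surjective augG) (he : Continuous e) :
    Literature.AnabelianGeometry.SemiGraphs.ArithQuasiGeometricCorrespondenceStatementCompat 𝔊 ℍ e augG augH
      btemp := by
  haveI : (e.symm.toMonoidHom.comp augH).ker.Normal := MonoidHom.normal_ker _
  -- the chart-level binders of v4 (Thm 3.7 (iii) at `𝔾`, the p.65 commensurators, slimness, a vertex)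
  have hEgeom := ProfiniteSemiGraph.hEgeom_decompositionDataOfChart h𝒢iii h𝒢 R𝒢 ι𝒢 hι𝒢 augG hex𝒢 A𝒢
  have hadj := ProfiniteSemiGraph.hadj_decompositionDataOfChart h𝒢iii h𝒢 R𝒢 ι𝒢 hι𝒢 augG hex𝒢 A𝒢
  have hcommV := fun v : 𝒢.graph.Vertex =>
    (ProfiniteSemiGraph.decompositionDataOfChart_vertGp_inf_ker h𝒢.thm37Hypotheses R𝒢 ι𝒢 hι𝒢 augG
      hex𝒢 v).2
  have hcommV' := fun w : ℋ.graph.Vertex =>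
    (ProfiniteSemiGraph.decompositionDataOfChart_vertGp_inf_ker hℋ.thm37Hypotheses Rℋ ιℋ hιℋ
      (e.symm.toMonoidHom.comp augH) hexℋ w).2
  have hslim := ProfiniteSemiGraph.hslim_decompositionDataOfChart hℋ.thm37Hypotheses Rℋ ιℋ hιℋ
    hιℋe.continuous (e.symm.toMonoidHom.comp augH) hexℋ Aℋ
  have hV : Nonempty 𝒢.graph.Vertex := h𝒢.hasVertex
  -- the datum `ι g := ι_ℍ ∘ φ̂_g ∘ ι_𝔾⁻¹` on `Ker aug_𝔊`
  obtain ⟨s, hs⟩ := exists_kerSection_of_range_eq_ker ι𝒢 hι𝒢 augG hex𝒢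
  let ι : (𝔊.G ⟶ ℍ.G) → (augG.ker →* Htp) := fun g => (ιℋ.comp (rep g).toMonoidHom).comp s
  have hι : ∀ (g : 𝔊.G ⟶ ℍ.G) (x : augG.ker) (y : c𝒢.G), (x : Gtp) = ι𝒢 y →
      ι g x = ιℋ (rep g y) := by
    intro g x y hxy
    have hsx : s x = y := hι𝒢 (by rw [hs, hxy])
    change ιℋ (rep g (s x)) = _
    rw [hsx]
  have hmem : ∀ y : c𝒢.G, ι𝒢 y ∈ augG.ker := fun y => hex𝒢.le ⟨y, rfl⟩
  -- the kernel-level dictionary of `ι`, derived from the chart-level one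
  have hιbtemp : ∀ (φ : ArithHom 𝓥 𝔊 ℍ) (h₁ : φ.IsLocallyOpen) (h₂ : ArithHom.IsOverA 𝔊 ℍ e φ),
      ∃ δ ∈ (e.symm.toMonoidHom.comp augH).ker,
        ∀ x : augG.ker, btemp φ h₁ h₂ x = δ * ι φ.geom x * δ⁻¹ := by
    intro φ h₁ h₂
    obtain ⟨δ, hδ, h⟩ := hbtempRep φ h₁ h₂
    refine ⟨δ, hδ, fun x => ?_⟩
    rw [hι φ.geom x (s x) (hs x).symm, ← h (s x), hs]
  have hιG : ∀ (g : 𝔊.G ⟶ ℍ.G) (a : 𝔊.PA) (γ : Gtp), augG γ = a →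
      ∃ δ ∈ (e.symm.toMonoidHom.comp augH).ker, ∀ x : augG.ker, ι ((𝔊.ρ a).hom ≫ g) x =
        δ * ι g ⟨γ * x * γ⁻¹, (MonoidHom.normal_ker augG).conj_mem _ x.2 γ⟩ * δ⁻¹ := by
    intro g a γ hγ
    obtain ⟨δ, hδ, h⟩ := hrepG g a γ hγ
    refine ⟨δ, hδ, fun x => ?_⟩
    rw [hι _ x (s x) (hs x).symm,
      hι g ⟨γ * x * γ⁻¹, (MonoidHom.normal_ker augG).conj_mem _ x.2 γ⟩ (s _) (hs _).symm]
    exact h (s x) (s _) (by rw [hs, hs])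
  have hιH : ∀ (g : 𝔊.G ⟶ ℍ.G) (a : 𝔊.PA) (η : Htp), (e.symm.toMonoidHom.comp augH) η = a →
      ∃ δ ∈ (e.symm.toMonoidHom.comp augH).ker,
        ∀ x : augG.ker, ι (g ≫ (ℍ.ρ (e a)).hom) x = δ * (η * ι g x * η⁻¹) * δ⁻¹ := by
    intro g a η hη
    obtain ⟨δ, hδ, h⟩ := hrepH g a η hη
    refine ⟨δ, hδ, fun x => ?_⟩
    rw [hι _ x (s x) (hs x).symm, hι g x (s x) (hs x).symm]
    exact h (s x)
  have hιinj : ∀ g₁ g₂ : 𝔊.G ⟶ ℍ.G,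
      (∃ δ ∈ (e.symm.toMonoidHom.comp augH).ker, ∀ x : augG.ker, ι g₁ x = δ * ι g₂ x * δ⁻¹) →
        g₁ = g₂ := by
    rintro g₁ g₂ ⟨δ, hδ, h⟩
    rw [← hexℋ] at hδ
    obtain ⟨k, rfl⟩ := hδ
    refine hrepInj g₁ g₂ k fun y => hιℋ ?_
    have hy := h ⟨ι𝒢 y, hmem y⟩
    rw [hι g₁ _ y rfl, hι g₂ _ y rfl] at hy
    rw [map_mul, map_mul, map_inv, hy]
  -- `hCor39c` through the charts
  have hCor39c := ProfiniteSemiGraph.hCor39c_of_repSurj h𝒢iii hℋiii h𝒢 hℋ R𝒢 Rℋ ι𝒢 ιℋ hι𝒢 hι𝒢c hιℋ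
    hιℋe augG (e.symm.toMonoidHom.comp augH) hex𝒢 hexℋ Aℋ rep hrepSurj ι hι
  -- the three ι-shadows at `g = φ.geom`, for every LOCALLY OPEN `φ` (Cor 3.9 (a) at the pair, ascended)
  have hsh : ∀ (φ : ArithHom 𝓥 𝔊 ℍ), φ.IsLocallyOpen →
      ∃ (F : Hom 𝒢 ℋ), F.IsLocallyOpen ∧ F.CompatV c𝒢 cℋ (rep φ.geom) ∧ F.CompatE c𝒢 cℋ (rep φ.geom) := by
    intro φ h₁
    obtain ⟨F, θ, hF, hiso⟩ := hrepOpen φ h₁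
    exact ⟨F, hF, F.compat_of_chartPullbackWith_iso θ c𝒢 cℋ (rep φ.geom) hiso⟩
  have h1c := Thm54iii.h1c_of_iota augG (e.symm.toMonoidHom.comp augH) btemp hIIG hIIH haugH hcommV
    hcommV' hEgeom ι hιbtemp (fun φ h₁ => by
      obtain ⟨F, hF, hVc, hEc⟩ := hsh φ h₁
      exact (ProfiniteSemiGraph.iotaShadows_of_compatVAt h𝒢iii hℋiii h𝒢 hℋ R𝒢 Rℋ ι𝒢 ιℋ hι𝒢 hιℋ
        hιℋe augG (e.symm.toMonoidHom.comp augH) hex𝒢 hexℋ A𝒢 F (rep φ.geom) hF hVc hEc (ι φ.geom)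
        (hι φ.geom)).2.2)
  refine (arithQuasiGeometricCorrespondenceStatementCompat_iff 𝔊 ℍ e augG augH btemp).mpr ⟨?_, ?_, ?_⟩
  · -- clause 1: Thm 5.4 (ii) + Rmk 5.3.1 + `hv`/`hb` from the per-`φ` shadows, and the compatibility clause
    intro φ h₁ h₂
    obtain ⟨F, hF, hVc, hEc⟩ := hsh φ h₁
    obtain ⟨⟨fv, hfv⟩, ⟨fb, hfb⟩, -⟩ := ProfiniteSemiGraph.iotaShadows_of_compatVAt h𝒢iii hℋiii h𝒢 hℋ
      R𝒢 Rℋ ι𝒢 ιℋ hι𝒢 hιℋ hιℋe augG (e.symm.toMonoidHom.comp augH) hex𝒢 hexℋ A𝒢 F (rep φ.geom) hF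
      hVc hEc (ι φ.geom) (hι φ.geom)
    obtain ⟨δ, -, hδ⟩ := hιbtemp φ h₁ h₂
    have hgeoV : ∀ v : 𝒢.graph.Vertex, ∃ g : Htp,
        MapsOntoOpenSubgroupOf (btemp φ h₁ h₂) ((decompositionDataOfChart R𝒢 ι𝒢).vertGp v ⊓ augG.ker)
          (conjSubgroup g ((decompositionDataOfChart Rℋ ιℋ).vertGp (fv v)) ⊓
            (e.symm.toMonoidHom.comp augH).ker) := by
      intro v
      obtain ⟨x, hle, hopen⟩ := hfv v
      exact ⟨δ * x, mapsOntoOpenSubgroupOf_of_kerAgree hδ _ _ x hle hopen⟩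
    have hgeoE : ∀ b : 𝒢.graph.Branch, ∃ g : Htp,
        MapsOntoOpenSubgroupOf (btemp φ h₁ h₂) ((decompositionDataOfChart R𝒢 ι𝒢).brGp b ⊓ augG.ker)
          (conjSubgroup g ((decompositionDataOfChart Rℋ ιℋ).brGp (fb b)) ⊓
            (e.symm.toMonoidHom.comp augH).ker) := by
      intro b
      obtain ⟨x, hle, hopen⟩ := hfb b
      exact ⟨δ * x, mapsOntoOpenSubgroupOf_of_kerAgree hδ _ _ x hle hopen⟩
    have hv := hv_of_geomOpen haugH hcommV hcommV' hRH fv hgeoV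
    have hb := hb_of_geomOpen haugH hcommB hcommB' hRH fb hgeoE
    refine (isArithCompatiblyQuasiGeometric_iff _ _ _).mpr ⟨?_, h1c φ h₁ h₂⟩
    exact isArithQuasiGeometric_of_statementII hIIG hIIH (hcont φ h₁ h₂) (hover φ h₁ h₂)
      (hV_of_compat haugH (hcont φ h₁ h₂) (hover φ h₁ h₂) hRG hRH fv hv)
      (hE_of_compat haugH (hcont φ h₁ h₂) (hover φ h₁ h₂) hRG hRH fb hb)
  · -- clause 2: forward half unconditional, backward half = injectivity (`hinj_of_geometric`)
    exact Thm54iii.innerEquiv_iff_exists_conj_of_injective btemp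
      (Thm54iii.hinj_of_geometric augG (e.symm.toMonoidHom.comp augH) btemp hover ι hιinj hιbtemp hsurjG
        𝔊.slim)
  · -- clause 3, compatible reading: `clause3Compat_of_geometric'` through the discharged `hCor39c`
    intro f hf
    have hf' := (isArithCompatiblyQuasiGeometric_iff _ _ _).mp hf
    exact Thm54iii.clause3Compat_of_geometric' augG (e.symm.toMonoidHom.comp augH) btemp hIIG hIIH hRG hRH
      haugH hcommV' hslim hadj hover ι hιG hιH hιinj hιbtemp hCor39c hsurjG he hV f hf'.1 hf'.2

end Literature.AnabelianGeometry.SemiGraphs
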